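import Summits.Ventures.CertifiedArithmetic.LowPrec.DirectedMirror

/-!
# Directed rounding: the `RZ` column is the `RD` column on non-negative results

HONEST FRAMING (venture CertifiedArithmetic / cell `pub-lowprec`): certified error envelopes and
provably optimal rounding/accumulation schemes for low-precision formats under stated cost models;
every table by two implementations; no hardware or vendor claims.

`roundTowardZero` agrees in value with `roundDown` on `x ≥ 0` and with `roundUp` on `x < 0`, so
its error at `x` is the `roundDown` error at `|x|` (using the mirror `DirectedMirror`). TABLE FORM:
over operand sets closed under `flipSign` (all of `F_φ₁ × F_φ₂`), a normal-range relative bound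
with threshold `lo` and constant `c` holds for every sum / product under `RZ` iff it holds under
`RD` for every sum / product whose exact value is `≥ 0`; in particular the `RD` (= `RU`)
constant of a table always dominates its `RZ` constant (`c_RZ ≤ c_RD`). The converse domination
fails: for
`E3M2 × E3M2 → E3M2` the sharp constants are `c_RZ = 1/9 < 1/7 = c_RD` (kernel rows
`E3M2_E3M2_mul_E3M2_relRZ_normal` / `_relRD_normal` in `EnvelopesDirectedE3M2Mul`), because the
`RD` maximiser is a NEGATIVE product rounded away from zero. (THEOREMS-R1 Theorem E5; ENVELOPES.md
directed columns.) [cite: Higham2002ASNA, §2.1]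
-/

namespace Literature.ComputerArithmetic.FloatingPoint

namespace MiniFloat

variable {φ : Format}

/-- On `x ≥ 0`, `RZ` and `RD` agree in value. [cite: IEEE7542019, §4.3.2] -/
theorem toRat_roundTowardZero_eq_roundDown {x : ℚ} (hx : 0 ≤ x) :
    (roundTowardZero φ x).toRat = (roundDown φ x).toRat := by
  rw [toRat_roundTowardZero, toRat_roundDown, if_neg (not_lt.mpr hx), if_neg (not_lt.mpr hx)]

/-- On `x < 0`, `RZ` and `RU` agree in value. [cite: IEEE7542019, §4.3.2] -/
theorem toRat_roundTowardZero_eq_roundUp {x : ℚ} (hx : x < 0) :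
    (roundTowardZero φ x).toRat = (roundUp φ x).toRat := by
  rw [toRat_roundTowardZero, toRat_roundUp, if_pos hx, if_pos hx]

/-- The `RZ` error at `x` is the `RD` error at `|x|`. [folklore] -/
theorem abs_roundTowardZero_sub (x : ℚ) :
    |(roundTowardZero φ x).toRat - x| = |(roundDown φ |x|).toRat - (|x|)| := by
  by_cases h : 0 ≤ x
  · rw [toRat_roundTowardZero_eq_roundDown h, abs_of_nonneg h]
  · have h' : x < 0 := not_le.mp h
    rw [toRat_roundTowardZero_eq_roundUp h', abs_of_neg h', abs_roundDown_neg_sub]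

variable {φ₁ φ₂ : Format}

/-- TABLE FORM, sums: the `RZ` normal-range relative bound over all sums is EQUIVALENT to the `RD`
bound over the sums with non-negative exact value. [cite: Higham2002ASNA, §2.1] -/
theorem relBound_roundTowardZero_add_iff_roundDown_nonneg (ψ : Format) (lo c : ℚ) :
    (∀ (a : MiniFloat φ₁) (b : MiniFloat φ₂), lo ≤ |a.toRat + b.toRat| →
        |a.toRat + b.toRat| ≤ ψ.maxRat →
          |(roundTowardZero ψ (a.toRat + b.toRat)).toRat - (a.toRat + b.toRat)|
            ≤ c * |a.toRat + b.toRat|) ↔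
      (∀ (a : MiniFloat φ₁) (b : MiniFloat φ₂), 0 ≤ a.toRat + b.toRat →
        lo ≤ |a.toRat + b.toRat| → |a.toRat + b.toRat| ≤ ψ.maxRat →
          |(roundDown ψ (a.toRat + b.toRat)).toRat - (a.toRat + b.toRat)|
            ≤ c * |a.toRat + b.toRat|) := by
  constructor
  · intro h a b h0 hlo hhi
    have key := h a b hlo hhi
    rwa [toRat_roundTowardZero_eq_roundDown h0] at key
  · intro h a b hlo hhi
    by_cases h0 : 0 ≤ a.toRat + b.toRat
    · rw [toRat_roundTowardZero_eq_roundDown h0]; exact h a b h0 hlo hhi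
    · have h0 : a.toRat + b.toRat < 0 := not_le.mp h0
      have key := h a.flipSign b.flipSign
      simp only [toRat_flipSign] at key
      rw [show -a.toRat + -b.toRat = -(a.toRat + b.toRat) by ring, abs_neg,
        abs_roundDown_neg_sub] at key
      rw [toRat_roundTowardZero_eq_roundUp h0]
      exact key (by linarith) hlo hhi

/-- DOMINATION, sums: the `RD` constant of a table bounds its `RZ` column (`c_RZ ≤ c_RD`).
[cite: Higham2002ASNA, §2.1] -/
theorem relBound_roundTowardZero_add_of_roundDown (ψ : Format) (lo c : ℚ)
    (h : ∀ (a : MiniFloat φ₁) (b : MiniFloat φ₂), lo ≤ |a.toRat + b.toRat| →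
        |a.toRat + b.toRat| ≤ ψ.maxRat →
          |(roundDown ψ (a.toRat + b.toRat)).toRat - (a.toRat + b.toRat)|
            ≤ c * |a.toRat + b.toRat|) :
    ∀ (a : MiniFloat φ₁) (b : MiniFloat φ₂), lo ≤ |a.toRat + b.toRat| →
        |a.toRat + b.toRat| ≤ ψ.maxRat →
          |(roundTowardZero ψ (a.toRat + b.toRat)).toRat - (a.toRat + b.toRat)|
            ≤ c * |a.toRat + b.toRat| :=
  (relBound_roundTowardZero_add_iff_roundDown_nonneg ψ lo c).mpr fun a b _ => h a b

/-- TABLE FORM, products: the `RZ` bound over all products is equivalent to the `RD` bound over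
the products with non-negative exact value (flip `(-a) · b = -(a · b)`).
[cite: Higham2002ASNA, §2.1] -/
theorem relBound_roundTowardZero_mul_iff_roundDown_nonneg (ψ : Format) (lo c : ℚ) :
    (∀ (a : MiniFloat φ₁) (b : MiniFloat φ₂), lo ≤ |a.toRat * b.toRat| →
        |a.toRat * b.toRat| ≤ ψ.maxRat →
          |(roundTowardZero ψ (a.toRat * b.toRat)).toRat - (a.toRat * b.toRat)|
            ≤ c * |a.toRat * b.toRat|) ↔
      (∀ (a : MiniFloat φ₁) (b : MiniFloat φ₂), 0 ≤ a.toRat * b.toRat →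
        lo ≤ |a.toRat * b.toRat| → |a.toRat * b.toRat| ≤ ψ.maxRat →
          |(roundDown ψ (a.toRat * b.toRat)).toRat - (a.toRat * b.toRat)|
            ≤ c * |a.toRat * b.toRat|) := by
  constructor
  · intro h a b h0 hlo hhi
    have key := h a b hlo hhi
    rwa [toRat_roundTowardZero_eq_roundDown h0] at key
  · intro h a b hlo hhi
    by_cases h0 : 0 ≤ a.toRat * b.toRat
    · rw [toRat_roundTowardZero_eq_roundDown h0]; exact h a b h0 hlo hhi
    · have h0 : a.toRat * b.toRat < 0 := not_le.mp h0
      have key := h a.flipSign b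
      simp only [toRat_flipSign] at key
      rw [neg_mul, abs_neg, abs_roundDown_neg_sub] at key
      rw [toRat_roundTowardZero_eq_roundUp h0]
      exact key (by linarith) hlo hhi

/-- DOMINATION, products: `c_RZ ≤ c_RD`. [cite: Higham2002ASNA, §2.1] -/
theorem relBound_roundTowardZero_mul_of_roundDown (ψ : Format) (lo c : ℚ)
    (h : ∀ (a : MiniFloat φ₁) (b : MiniFloat φ₂), lo ≤ |a.toRat * b.toRat| →
        |a.toRat * b.toRat| ≤ ψ.maxRat →
          |(roundDown ψ (a.toRat * b.toRat)).toRat - (a.toRat * b.toRat)|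
            ≤ c * |a.toRat * b.toRat|) :
    ∀ (a : MiniFloat φ₁) (b : MiniFloat φ₂), lo ≤ |a.toRat * b.toRat| →
        |a.toRat * b.toRat| ≤ ψ.maxRat →
          |(roundTowardZero ψ (a.toRat * b.toRat)).toRat - (a.toRat * b.toRat)|
            ≤ c * |a.toRat * b.toRat| :=
  (relBound_roundTowardZero_mul_iff_roundDown_nonneg ψ lo c).mpr fun a b _ => h a b

end MiniFloat

end Literature.ComputerArithmetic.FloatingPoint
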